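import Summits.ValiantsHypothesis.ValiantsHypothesis.Theorems.SymPencilLagrangianInvariant
import Summits.ValiantsHypothesis.ValiantsHypothesis.Theorems.SymPencilHomogeneousDropRankCodim

/-!
# Route `SymPencil` — kernel rows are invariant under the kernel directions, one step past the
# Lagrangian case (tool file, `--supports` stmt-ValiantsHypothesis-5674; nothing here bears on
# `VP ≠ VNP`)

`SymPencilLagrangianInvariant.mulVec_mem_range_of_lagrangian`: if `B = im b` is `D⁻¹`-isotropic of
HALF dimension (`|ι'| = 2 dim B`) and the first origin moment vanishes, then
`C(v) D⁻¹ B ⊆ B` for every `v ∈ ker b`.  Here (`mulVec_mem_range_of_isotropic`) the dimension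
hypothesis is relaxed to `|ι'| ≤ 2 dim B + 1` at the price of one more input — the vector
`t = C(v) D⁻¹ y` (`y ∈ B`) is itself `D⁻¹`-isotropic:

  `(C(v) D⁻¹ b(z))ᵀ D⁻¹ (C(v) D⁻¹ b(z)) = 0`   for all `z`

(for a symmetric representation of `per_4` with a one-row kernel this is the `s²`-coefficient of
the second origin moment along `z + s v`, `SymPencilSdcPerFourTwentySeven`).  Proof: `t` is
`D⁻¹`-orthogonal to `B` (polarised first moment) and isotropic, so `B + K t` is totally isotropic;
a totally isotropic subspace of the non-degenerate form `D⁻¹` has `2 dim ≤ |ι'| ≤ 2 dim B + 1`,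
hence `B + K t = B`.  This carries the one-row cell kill from size `25` (`(12,4,0)`, Lagrangian)
to size `26` (`(12,4,1)`, defect one).  Elementary. [folklore]
-/

noncomputable section

-- single-conjunct layout: Sub = Summit, duplicated namespace component intended
set_option linter.dupNamespace false

namespace Summit.ValiantsHypothesis.ValiantsHypothesis.Theorems.SymPencilKernelInvariance

open Matrix Module
open Summit.ValiantsHypothesis.ValiantsHypothesis.Theorems.SymPencilHomogeneousDropTools
open Summit.ValiantsHypothesis.ValiantsHypothesis.Theorems.SymPencilHomogeneousDropRankCodim
open Summit.ValiantsHypothesis.ValiantsHypothesis.Theorems.SymPencilLagrangianKernel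

universe u

variable {k : Type u} [Field k] [CharZero k] {ι' : Type*} [Fintype ι'] [DecidableEq ι']
  {V : Type*} [AddCommGroup V] [Module k V]

/-- **Kernel rows are invariant under the kernel directions (defect `≤ 1`)**: if `im b` is
`D⁻¹`-isotropic with `|ι'| ≤ 2 dim (im b) + 1`, the first origin moment vanishes, and the vectors
`C(v) D⁻¹ b(z)` are `D⁻¹`-isotropic for the kernel direction `v`, then `C(v) D⁻¹ (im b) ⊆ im b`.
[folklore] -/
theorem mulVec_mem_range_of_isotropic {D : Matrix ι' ι' k} (hD : IsUnit D.det) (hDs : Dᵀ = D)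
    (b : V →ₗ[k] (ι' → k)) (C : V →ₗ[k] Matrix ι' ι' k) (hCs : ∀ z, (C z)ᵀ = C z)
    (hi : ∀ z, b z ⬝ᵥ D⁻¹ *ᵥ b z = 0)
    (hii : ∀ z, b z ⬝ᵥ (D⁻¹ * C z * D⁻¹) *ᵥ b z = 0)
    (hL : Fintype.card ι' ≤ 2 * Module.finrank k (LinearMap.range b) + 1)
    (v : V) (hv : b v = 0)
    (hq : ∀ z, (C v *ᵥ (D⁻¹ *ᵥ b z)) ⬝ᵥ D⁻¹ *ᵥ (C v *ᵥ (D⁻¹ *ᵥ b z)) = 0)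
    (y : ι' → k) (hy : y ∈ LinearMap.range b) :
    C v *ᵥ (D⁻¹ *ᵥ y) ∈ LinearMap.range b := by
  classical
  have hDis : (D⁻¹)ᵀ = D⁻¹ := by rw [Matrix.transpose_nonsing_inv, hDs]
  have hDiu : IsUnit D⁻¹ :=
    (Matrix.isUnit_iff_isUnit_det _).2 (Matrix.isUnit_nonsing_inv_det_iff.2 hD)
  set B := LinearMap.range b with hBdef
  -- polarised isotropy on `B`
  have hsymm0 : ∀ y y' : ι' → k, y ⬝ᵥ D⁻¹ *ᵥ y' = y' ⬝ᵥ D⁻¹ *ᵥ y := fun y y' => by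
    rw [dotProduct_mulVec_of_transpose_eq hDis, dotProduct_comm]
  have hpol : ∀ y ∈ B, ∀ y' ∈ B, y ⬝ᵥ D⁻¹ *ᵥ y' = 0 := by
    rintro _ ⟨z, rfl⟩ _ ⟨z', rfl⟩
    have h := hi (z + z')
    rw [map_add, Matrix.mulVec_add, dotProduct_add, add_dotProduct, add_dotProduct, hi z, hi z',
      hsymm0 (b z') (b z), zero_add, add_zero, ← two_mul] at h
    exact (mul_eq_zero.1 h).resolve_left two_ne_zero
  -- polarised first moment along the kernel
  have hker1 : ∀ z, (D⁻¹ *ᵥ b z) ⬝ᵥ C v *ᵥ (D⁻¹ *ᵥ b z) = 0 := by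
    intro z
    have h1 := hii (z + v)
    have h0 := hii z
    rw [map_add, hv, add_zero, map_add, sandwich₂_eq hDis, Matrix.add_mulVec, dotProduct_add] at h1
    rw [sandwich₂_eq hDis] at h0
    rwa [h0, zero_add] at h1
  have hsymm1 : ∀ (p q : ι' → k), p ⬝ᵥ C v *ᵥ q = q ⬝ᵥ C v *ᵥ p := fun p q => by
    rw [dotProduct_mulVec_of_transpose_eq (hCs v), dotProduct_comm]
  have hker2 : ∀ y ∈ B, ∀ y' ∈ B, (D⁻¹ *ᵥ y) ⬝ᵥ C v *ᵥ (D⁻¹ *ᵥ y') = 0 := by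
    rintro _ ⟨z, rfl⟩ _ ⟨z', rfl⟩
    have h := hker1 (z + z')
    rw [map_add, Matrix.mulVec_add, Matrix.mulVec_add, dotProduct_add, add_dotProduct,
      add_dotProduct, hker1 z, hker1 z', hsymm1 (D⁻¹ *ᵥ b z') (D⁻¹ *ᵥ b z), zero_add,
      add_zero, ← two_mul] at h
    exact (mul_eq_zero.1 h).resolve_left two_ne_zero
  -- the vector `t` and the isotropic subspace `B + k t`
  obtain ⟨z₀, rfl⟩ := hy
  set t : ι' → k := C v *ᵥ (D⁻¹ *ᵥ b z₀) with ht
  have htt : t ⬝ᵥ D⁻¹ *ᵥ t = 0 := hq z₀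
  have hBt : ∀ y' ∈ B, y' ⬝ᵥ D⁻¹ *ᵥ t = 0 := fun y' hy' => by
    rw [dotProduct_mulVec_of_transpose_eq hDis, ht, hsymm1]
    exact hker2 _ ⟨z₀, rfl⟩ y' hy'
  set B₁ : Submodule k (ι' → k) := B ⊔ k ∙ t with hB₁
  have hiso : ∀ x ∈ B₁, x ⬝ᵥ D⁻¹ *ᵥ x = 0 := by
    intro x hx
    rw [hB₁, Submodule.mem_sup] at hx
    obtain ⟨y', hy', w, hw, rfl⟩ := hx
    obtain ⟨a, rfl⟩ := Submodule.mem_span_singleton.1 hw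
    rw [Matrix.mulVec_add, Matrix.mulVec_smul, dotProduct_add, add_dotProduct, add_dotProduct,
      dotProduct_smul, smul_dotProduct, smul_dotProduct, dotProduct_smul, hpol y' hy' y' hy',
      hBt y' hy', hsymm0 t y', hBt y' hy', htt]
    simp
  have hdim : 2 * Module.finrank k B₁ ≤ Fintype.card ι' := by
    have h := rank_add_two_mul_finrank_le_of_quadratic_form_eq_zero hDis B₁ hiso
    rw [Matrix.rank_of_isUnit _ hDiu] at h
    omega
  have hB₁le : Module.finrank k B₁ ≤ Module.finrank k B := by omega
  have hBeq : B = B₁ := Submodule.eq_of_le_of_finrank_le le_sup_left hB₁le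
  have htB : t ∈ B₁ := Submodule.mem_sup_right (Submodule.mem_span_singleton_self t)
  rw [← hBeq] at htB
  exact htB

end Summit.ValiantsHypothesis.ValiantsHypothesis.Theorems.SymPencilKernelInvariance

end
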